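/-
COR-CM (cell pub-hodgecm2, stage 2 of the Hodge ladder) — DELREC (PLANNER-D «Deligne record → printed constituents», TABLE v1 row S1b;
seat prover-pub-hodgecm2-delrec-p4-g0-0).  THE CONVERSE: the tree's packaged record `UnitaryCanonicalModel.exists_recordSystem` (the `h`
displayed by every END edition) IMPLIES the printed existential `UnitaryCanonicalModel.canonicalModel_exists_printed` (`C_Del`, row L1), and
hence `exists_recordSystem ↔ canonicalModel_exists_printed` in the kernel (with row S1a's `exists_recordSystem_of_printed`).  FALLBACK EDITION S1b′:
row S0's system-level Borel uniqueness is proved locally (§0) instead of imported.  THEOREMS ONLY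
(kernel lane); nothing landed is edited or restated; new declaration names under `Summit.HodgeConjecture.CorCM.DelRec`.  FRAMING: HC_CM is NOT
proved; no pointer ∕ label ∕ count move is claimed; the displayed citation of [Deligne 1979] is NOT discharged — it is RE-SHAPED into its printed
form, kernel-equivalently.
-/
import Literature.AlgebraicGeometry.ShimuraVarieties.UnitaryShimuraCanonicalModelPrinted
import Summits.HodgeConjecture.CorCM.DelRec.RecordSystemOfPrinted
import HarnessLib

/-!
# `exists_recordSystem → canonicalModel_exists_printed`, and the kernel equivalence `exists_recordSystem ↔ canonicalModel_exists_printed`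

[Deligne1979ShimuraVarieties] 2.2.5 (PDF p. 29 L16–28 of Milne's translation): «A canonical model `M(G,X)` of `M_ℂ(G,X)` is a form over `E(G,X)`
of `M_ℂ(G,X)` … such that … (b) … the Galois group … acts through the action 2.2.4.  By "form" we mean a scheme `M` over `E(G,X)` equipped with …
an equivariant isomorphism `M ⊗_{E(G,X)} ℂ ⥲ M_ℂ(G,X)`»; Cor. 2.7.21 (PDF p. 52): canonical models exist (here `G^{ad} = Res PU(H)` of type `A`,
`G^{der} = Res SU(H)` simply connected).  Row L1 types this, at the one datum `(Res_{L⁺/ℚ} U(H), 𝔹²)` of [Liu2021] App. C, as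
`canonicalModel_exists_printed`: for EVERY complex record system `Sc` (= any algebraisation `M_ℂ(G,X)` of `Sh_K(ℂ)`, 2.1.2 — all
`pts`-compatibly isomorphic, row S0 `ComplexRecordSystem.nonempty_isoOfPts`) there are smooth projective `L`-schemes `M_K`, functorial in
`K ≤ K₀`, an `L`-form `e : M ⊗_{L,τ} ℂ ≅ Sc.Mc`, and reciprocity (62) at the diagonal special pairs (`IsCanonicalDescentAt Sc M e`).

Main results (namespace `Summit.HodgeConjecture.CorCM.DelRec`):

* `isCanonicalDescentAt_trans` — TRANSPORT: a canonical descent `(M, e)` of `Sc` is a canonical descent `(M, e ≪≫ φ)` of `Sc'` along any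
  `pts`-compatible isomorphism `φ : Sc.Mc ≅ Sc'.Mc` (the descent points `e⁻¹(Sc.pts⁻¹ P)` and `(e ≪≫ φ)⁻¹(Sc'.pts⁻¹ P)` coincide);
* **`printed_of_exists_recordSystem : exists_recordSystem → canonicalModel_exists_printed`** — the converse of row S1a: given the datum and
  ANY `Sc`, the record system `S` provided by `exists_recordSystem` descends its shadow (row L1's `RecordSystem.isCanonicalDescentAt_self`),
  and the descent transports to `Sc` along row S0's isomorphism `S.complexRecordSystem.Mc ≅ Sc.Mc`;
* **`exists_recordSystem_iff_printed : exists_recordSystem ↔ canonicalModel_exists_printed`** — THE KERNEL EQUIVALENCE of the delrec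
  split (`→` here, `←` = row S1a `exists_recordSystem_of_printed`): the END's displayed binder `h` and the printed citation `C_Del` are
  interchangeable in the kernel, so every verdict on an END displaying `h` (T5 rows, mutation tests) transfers verbatim to the edition
  displaying `hDel : canonicalModel_exists_printed` (row S2), and conversely.

0 hypothesis binders of Prop-valued named facts in any theorem here (T5: n/a).  HC_CM is NOT proved; nothing displayed anywhere is inhabited
here; `canonicalModel_exists_printed` is NOT asserted.

## References
* [Deligne1979ShimuraVarieties] P. Deligne, *Variétés de Shimura: interprétation modulaire, et techniques de construction de modèles
  canoniques*, PSPM XXXIII.2 (1979): 2.1.2–2.1.4 (PDF p. 24), 2.2.4–2.2.5 (PDF p. 29), Cor. 2.7.21 (PDF p. 52) of Milne's translation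
  `paper:url-7710442a1cf6`.
* [Milne2005ShimuraVarieties] J. S. Milne, *Introduction to Shimura varieties* (2005/2017, `paper:url-b0e8e4ca1c12`): Thm. 3.14 p. 39, Cor. 3.16
  p. 40 (Borel uniqueness), Def. 12.8 (62) p. 114, Def. 12.10 p. 115.
* [Liu2021] Y. Liu, *Fourier–Jacobi cycles and arithmetic relative trace formula*, Camb. J. Math. 9 (2021), App. C §C.1 and Rem. C.2.
-/

set_option autoImplicit false

noncomputable section

open Function MulAction Topology NumberField IsDedekindDomain CategoryTheory CategoryTheory.Limits Matrix
  AlgebraicGeometry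
open scoped Matrix ComplexOrder
open Literature.AlgebraicGeometry.Motives
open Literature.NumberTheory.Automorphic Literature.NumberTheory.Automorphic.UnitaryGroup
open Literature.NumberTheory.Automorphic.Liu2021.AppendixC (C5.OpenCompactSubgroup C5.SmallLevel)
open Literature.Geometry.ComplexHyperbolic Literature.Geometry.ComplexHyperbolic.BallModel
open Literature.NumberTheory.Automorphic.ShimuraDissection
open Literature.AlgebraicGeometry.ShimuraVarieties Literature.AlgebraicGeometry.ShimuraVarieties.UnitaryCanonicalModel

namespace Summit.HodgeConjecture.CorCM.DelRec

variable {L : Type} [Field L] [NumberField L] [IsCMField L] {H : Matrix (Fin 3) (Fin 3) L}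
  {τ : L →+* ℂ} {T : GL (Fin 3) ℂ} {hT : formCongr (starRingEnd ℂ) T (H.map τ) = BallModel.J}
  {K₀ : C5.OpenCompactSubgroup ↥(finAdelic (↥(maximalRealSubfield L)) L (IsCMField.complexConj L) 3 H)}

/-! ## §0  System-level Borel uniqueness of the complex record system (row S0's statement, proved locally in this fallback edition) -/

set_option maxHeartbeats 1600000 in -- instance-heavy adelic / Shimura-set statement (as in the record files)
/-- **Uniqueness of the complex record SYSTEM** ([Deligne1979ShimuraVarieties] 2.1.2 «it follows from [3] that this structure is unique» (Borel),
for `K` variable; [Milne2005ShimuraVarieties] Thm. 3.14, Cor. 3.16): two complex record systems below `K₀` are isomorphic as functors on the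
small levels by a `pts`-compatible natural isomorphism — componentwise the tree's `ComplexRecord.nonempty_iso`, naturality because both
composites act as `[z, aK] ↦ [z, aK']` on complex points (`ComplexRecord.hecke_unique`).
[cite: Deligne1979ShimuraVarieties, 2.1.2–2.1.4 (PDF p. 24 of Milne's translation)] [cite: Milne2005ShimuraVarieties, Thm. 3.14 p. 39 and Cor. 3.16 p. 40] -/
theorem complexRecordSystem_nonempty_isoOfPts (Sc Sc' : ComplexRecordSystem L H τ T hT K₀) :
    ∃ e : Sc.Mc ≅ Sc'.Mc, ∀ (K : C5.SmallLevel K₀) (x : ComplexPoints (Sc.Mc.obj K)),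
      (Sc'.pts K) (AlgPoints.map (e.hom.app K) x) = (Sc.pts K) x := by
  classical
  have hK : ∀ K : C5.SmallLevel K₀, ∃ e : Sc.Mc.obj K ≅ Sc'.Mc.obj K,
      ∀ x : ComplexPoints (Sc.Mc.obj K), Sc'.pts K (AlgPoints.map e.hom x) = Sc.pts K x := by
    intro K
    obtain ⟨e, he⟩ := ComplexRecord.nonempty_iso (Sc.record K) (Sc'.record K)
    exact ⟨e, he⟩
  choose e he using hK
  -- `map (e K).hom` sends `Sc.pts⁻¹ P` to `Sc'.pts⁻¹ P`
  have he' : ∀ (K : C5.SmallLevel K₀) (P : ShimuraSet L H τ T hT K.1.1),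
      AlgPoints.map (e K).hom ((Sc.pts K).symm P) = (Sc'.pts K).symm P := by
    intro K P
    apply (Sc'.pts K).injective
    rw [he K, Homeomorph.apply_symm_apply, Homeomorph.apply_symm_apply]
  -- the transitions send `pts⁻¹ [z, aK]` to `pts⁻¹ [z, aK']` (clause `map_pts`)
  have htr : ∀ (S : ComplexRecordSystem L H τ T hT K₀) (K K' : C5.SmallLevel K₀) (f : K ⟶ K') (z : Ball)
      (a : finAdelic (↥(maximalRealSubfield L)) L (IsCMField.complexConj L) 3 H),
      AlgPoints.map (S.Mc.map f) ((S.pts K).symm (ShimuraSet.mk L H τ T hT K.1.1 z a)) =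
        (S.pts K').symm (ShimuraSet.mk L H τ T hT K'.1.1 z a) := fun S K K' f z a => by
    rw [← S.map_pts K K' f z a, Homeomorph.symm_apply_apply]
  refine ⟨NatIso.ofComponents (fun K => e K) (fun {K K'} f => ?_), fun K x => he K x⟩
  have h1 : ∀ (z : Ball) (a : finAdelic (↥(maximalRealSubfield L)) L (IsCMField.complexConj L) 3 H),
      AlgPoints.map (Sc.Mc.map f ≫ (e K').hom) ((Sc.pts K).symm (ShimuraSet.mk L H τ T hT K.1.1 z a)) =
        (Sc'.pts K').symm (ShimuraSet.mk L H τ T hT K'.1.1 z (a * 1)) := fun z a => by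
    rw [mul_one, AlgPoints.map_comp_apply, htr Sc K K' f z a, he' K']
  have h2 : ∀ (z : Ball) (a : finAdelic (↥(maximalRealSubfield L)) L (IsCMField.complexConj L) 3 H),
      AlgPoints.map ((e K).hom ≫ Sc'.Mc.map f) ((Sc.pts K).symm (ShimuraSet.mk L H τ T hT K.1.1 z a)) =
        (Sc'.pts K').symm (ShimuraSet.mk L H τ T hT K'.1.1 z (a * 1)) := fun z a => by
    rw [mul_one, AlgPoints.map_comp_apply, he' K, htr Sc' K K' f z a]
  exact (Sc.record K).hecke_unique (Sc'.record K') (g := 1) h1 h2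

/-! ## §1  Transport of a canonical descent along a `pts`-compatible isomorphism of complex record systems -/

set_option maxHeartbeats 1600000 in -- instance-heavy adelic / Shimura-set statement (as in the record files)
/-- **Transport of a canonical descent** ([Deligne1979ShimuraVarieties] 2.2.5 read about ANY complex model, 2.1.2 «unique [Borel]»): if
`(M, e)` is a canonical descent of the complex record system `Sc` — reciprocity (62) at the diagonal special pairs for the `Aut(ℂ/τL)`-action on
`M_K(ℂ)` read through `e` and `Sc.pts` — and `φ : Sc.Mc ≅ Sc'.Mc` is a `pts`-compatible isomorphism onto another complex record system `Sc'`
(row S0), then `(M, e ≪≫ φ)` is a canonical descent of `Sc'`: the points `(e ≪≫ φ)⁻¹(Sc'.pts⁻¹ [x, aK])` and `e⁻¹(Sc.pts⁻¹ [x, aK])` coincide.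
[cite: Deligne1979ShimuraVarieties, 2.1.2 and 2.2.4–2.2.5 (PDF pp. 24, 29 of Milne's translation)] [cite: Milne2005ShimuraVarieties, Def. 12.8 (62) p. 114] -/
theorem isCanonicalDescentAt_trans (Sc Sc' : ComplexRecordSystem L H τ T hT K₀) (M : C5.SmallLevel K₀ ⥤ SchemeOver L)
    (e : (M ⋙ Literature.AlgebraicGeometry.Motives.baseChangeHom τ) ≅ Sc.Mc) (he : IsCanonicalDescentAt Sc M e) (φ : Sc.Mc ≅ Sc'.Mc)
    (hφ : ∀ (K : C5.SmallLevel K₀) (x : ComplexPoints (Sc.Mc.obj K)), Sc'.pts K (AlgPoints.map (φ.hom.app K) x) = Sc.pts K x) :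
    IsCanonicalDescentAt Sc' M (e ≪≫ φ) := by
  letI : Algebra L ℂ := τ.toAlgebra
  intro K σ s hσ v₃ x hx d hd a
  -- `φ_K` sends `Sc.pts⁻¹ P` to `Sc'.pts⁻¹ P`, hence `(e ≪≫ φ)⁻¹_K (Sc'.pts⁻¹ P) = e⁻¹_K (Sc.pts⁻¹ P)`
  have hφ' : ∀ P : ShimuraSet L H τ T hT K.1.1, AlgPoints.map (φ.hom.app K) ((Sc.pts K).symm P) = (Sc'.pts K).symm P := fun P => by
    apply (Sc'.pts K).injective
    rw [hφ K, Homeomorph.apply_symm_apply, Homeomorph.apply_symm_apply]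
  have hP0 : ∀ P : ShimuraSet L H τ T hT K.1.1,
      AlgPoints.map ((e ≪≫ φ).inv.app K) ((Sc'.pts K).symm P) = AlgPoints.map (e.inv.app K) ((Sc.pts K).symm P) := fun P => by
    rw [Iso.trans_inv, NatTrans.comp_app, AlgPoints.map_comp_apply, ← hφ' P, ← AlgPoints.map_comp_apply (φ.hom.app K),
      Iso.hom_inv_id_app, AlgPoints.map_id_apply]
  -- lift the point identity under `(M_K(ℂ) ≃ (M_K)_τ(ℂ))⁻¹` by `congrArg` (a `rw` under this wrapper fails the motive check)
  have hP : ∀ P : ShimuraSet L H τ T hT K.1.1,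
      (AlgPoints.baseChangeEquiv τ (M.obj K)).symm (AlgPoints.map ((e ≪≫ φ).inv.app K) ((Sc'.pts K).symm P)) =
        (AlgPoints.baseChangeEquiv τ (M.obj K)).symm (AlgPoints.map (e.inv.app K) ((Sc.pts K).symm P)) :=
    fun P => congrArg _ (hP0 P)
  have h1 := congrArg (fun t => σ • t) (hP (ShimuraSet.mk L H τ T hT K.1.1 x a))
  exact h1.trans ((he K σ s hσ v₃ x hx d hd a).trans (hP (ShimuraSet.mk L H τ T hT K.1.1 x (d * a))).symm)

/-! ## §2  The converse and the kernel equivalence -/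

/-- **`exists_recordSystem → canonicalModel_exists_printed`** (the converse of row S1a; «where true» — it IS true): at a datum
`(L, H, τ, T, hT)` with `hpos`, `hanis`, a small level `K₀` with torsion-free conjugate arithmetic levels, and ANY complex record system `Sc`
below `K₀`, the record system `S` given by `exists_recordSystem` ([Deligne1979ShimuraVarieties] 2.2.5 + Cor. 2.7.21 as recorded in
`UnitaryShimuraCanonicalModel`) supplies the smooth projective `L`-models `S.M`; they descend the shadow `S.complexRecordSystem` along `Iso.refl`
(row L1's `RecordSystem.isCanonicalDescentAt_self` = the tree's `RecordSystem.descent_self`), and this descent transports to `Sc` along row S0's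
`pts`-compatible isomorphism `S.complexRecordSystem.Mc ≅ Sc.Mc` (`complexRecordSystem_nonempty_isoOfPts`, §0; `isCanonicalDescentAt_trans`).
[cite: Deligne1979ShimuraVarieties, 2.1.2, 2.2.5 and Cor. 2.7.21 (PDF pp. 24, 29, 52 of Milne's translation)] [cite: Milne2005ShimuraVarieties, Def. 12.8 (62) p. 114; Thm. 3.14 p. 39] -/
theorem printed_of_exists_recordSystem : exists_recordSystem → canonicalModel_exists_printed := by
  intro h L _ _ _ H τ T hT hpos hanis K₀ htf Sc
  obtain ⟨S⟩ := h L H τ T hT hpos hanis K₀ htf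
  obtain ⟨φ, hφ⟩ := complexRecordSystem_nonempty_isoOfPts S.complexRecordSystem Sc
  exact ⟨S.M, S.smooth, S.projective, Iso.refl (S.M ⋙ Literature.AlgebraicGeometry.Motives.baseChangeHom τ) ≪≫ φ,
    isCanonicalDescentAt_trans S.complexRecordSystem Sc S.M (Iso.refl _) S.isCanonicalDescentAt_self φ hφ⟩

/-- **THE KERNEL EQUIVALENCE OF THE DELREC SPLIT: `exists_recordSystem ↔ canonicalModel_exists_printed`.**  The packaged record `h` displayed
by every END edition (7 fields, 4 of them tree theorems: `HComp.nonempty_complexRecordSystem`, `ComplexRecord.nonempty_iso`) and the ONE printed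
existential of [Deligne1979ShimuraVarieties] 2.2.5 + Cor. 2.7.21 at the datum `(Res_{L⁺/ℚ} U(H), 𝔹²)` («`M_ℂ(G,X)` admits a model over
`E(G,X) = τ(L)`, smooth projective ([Liu2021] App. C §C.1), compatible with the transitions, on which `Aut(ℂ/τL)` acts at the diagonal special
points by (62)») are interchangeable in the kernel: `→` = `printed_of_exists_recordSystem` (this file), `←` = row S1a
`exists_recordSystem_of_printed` (a complex record system exists at every datum with no named fact, `HComp.nonempty_complexRecordSystem`, and
`RecordSystem.nonempty_of_descent`).  Consequently every verdict on an END displaying `h` transfers verbatim to the edition displaying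
`hDel : canonicalModel_exists_printed` and conversely.  Neither side is asserted; HC_CM is NOT proved.
[cite: Deligne1979ShimuraVarieties, 2.1.2–2.1.4, 2.2.5 and Cor. 2.7.21 (PDF pp. 24, 29, 52 of Milne's translation)]
[cite: Milne2005ShimuraVarieties, Def. 12.8 (62) p. 114; Def. 12.10 p. 115] [cite: Liu2021, App. C §C.1 and Rem. C.2] -/
theorem exists_recordSystem_iff_printed : exists_recordSystem ↔ canonicalModel_exists_printed :=
  ⟨printed_of_exists_recordSystem, exists_recordSystem_of_printed⟩

end Summit.HodgeConjecture.CorCM.DelRec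

end
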